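import Mathlib
import Summits.Ventures.HodgeRepro2.T6N41Glue

/-!
# T6N41Euler — Euler-product bookkeeping and the abstract main theorem of N4.1 (pre-M2, carrier-free)

Record: route/T5-N4.1-route-1.md v6.7 (N4.1.3) steps (P0) («write Λ = L_S · L^S»), (P3) («L^S(s) =
L^S(s, η₁′)·L^S(s, η₂′) = [∏_{v ∈ S_fin} P_{1,v} P_{2,v}] · L_fin(s, η₁′) · L_fin(s, η₂′)») and the
assembly (P4)–(P5).  The absolutely convergent Euler products of the record are carried here as
`Summable (fun v => f v - 1)` together with `∏' v, f v` (Mathlib's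
`Complex.multipliable_one_add_of_summable` turns the former into multipliability on every subset of
places), and the three manipulations of (P0)/(P3) are proved once:

* `tprod_eq_prod_mul_tprod_compl`: `∏_v f v = (∏_{v ∈ S} f v) · ∏_{v ∉ S} f v`;
* `tprod_mul_of_summable`: `∏_v f v g v = (∏_v f v)(∏_v g v)`;
* `tprod_eq_of_eq_mul_off_finset`: if `f = g₁ g₂` off `S` then
  `∏_v f v = [(∏_S f)(∏_S g₁⁻¹ g₂⁻¹)] · (∏_v g₁ v) · (∏_v g₂ v)` — the (P3) identity with
  `Z = L_S · ∏_{S} P_{1,v} P_{2,v}`.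

`R1_of_eulerProducts` is then the whole N4.1 argument over ABSTRACT carriers (an index type of
places, local factors, the global functions): every printed input is a binder in the shape its M2
display will have — the Euler products and meromorphic continuations (Lapid–Rallis Thm 4, Iwasawa
Thm 3.1), the unramified identity off `S` ((P3)+(P7): Lapid–Rallis §7, Rogawski, Harris II, Mínguez,
Bump (5.23)), the zero-free shapes of the `S`-factors ((P2), discharged by the `T6N41Core` lemmas once
the shapes are displayed), the Iwasawa dichotomy (Thm 3.1 + Prop. 4.4) and the holomorphy under
`(H_loc)` (GQT Thm 11.4(ii)).  At M2 `N41_main` is this theorem applied to the lead's datum.  Its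
variant `R1_of_eulerProducts'` takes the doubling Euler product only as Lapid–Rallis print it («Define
`L = ∏_v L_v`», i.e. the value of the product wherever it converges): the absolute convergence is derived
from the Hecke products and the unramified identity (`summable_sub_one_of_eq_mul_off_finset`).
Nothing is displayed here (TARGET-T6 §7(c)).  §8(d): uses an L-value-free non-vanishing device: NO.
-/

namespace Summit.Ventures.HodgeRepro2.T6
namespace N41Core

open Filter Topology
open Summit.Ventures.HodgeRepro2.T5OrderCounting

/-! ### Absolutely convergent products -/

/-- An absolutely convergent Euler product (`∑ ‖f v − 1‖ < ∞`, carried as `Summable (f − 1)` in `ℂ`)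
is multipliable. -/
theorem multipliable_of_summable_sub_one {ι : Type*} {f : ι → ℂ}
    (hf : Summable (fun v => f v - 1)) : Multipliable f := by
  simpa using Complex.multipliable_one_add_of_summable hf

/-- Restriction of an absolutely convergent product to any subset of the index set is
multipliable. -/
theorem multipliable_subtype_of_summable_sub_one {ι : Type*} {f : ι → ℂ}
    (hf : Summable (fun v => f v - 1)) (p : ι → Prop) :
    Multipliable (f ∘ Subtype.val : {v // p v} → ℂ) :=
  multipliable_of_summable_sub_one (hf.subtype p)

/-- (P0): split an absolutely convergent product at a finite set `S` of places:
`∏_v f v = (∏_{v ∈ S} f v) · ∏_{v ∉ S} f v`. -/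
theorem tprod_eq_prod_mul_tprod_compl {ι : Type*} {f : ι → ℂ}
    (hf : Summable (fun v => f v - 1)) (S : Finset ι) :
    ∏' v, f v = (∏ v ∈ S, f v) * ∏' v : {v // v ∉ S}, f v := by
  have h1 := multipliable_subtype_of_summable_sub_one hf (fun v => v ∈ (S : Set ι))
  have h2 := multipliable_subtype_of_summable_sub_one hf (fun v => v ∈ (S : Set ι)ᶜ)
  rw [← Multipliable.tprod_mul_tprod_compl (s := (S : Set ι)) h1 h2]
  congr 1
  exact Finset.tprod_subtype S f

/-- Two absolutely convergent products multiply termwise. -/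
theorem tprod_mul_of_summable {ι : Type*} {f g : ι → ℂ} (hf : Summable (fun v => f v - 1))
    (hg : Summable (fun v => g v - 1)) : ∏' v, f v * g v = (∏' v, f v) * ∏' v, g v :=
  Multipliable.tprod_mul (multipliable_of_summable_sub_one hf) (multipliable_of_summable_sub_one hg)

/-- (P3): if `f v = g₁ v · g₂ v` for every place `v ∉ S` and the `g_i` do not vanish on `S`, then
`∏_v f v = [(∏_{v ∈ S} f v) · ∏_{v ∈ S} (g₁ v)⁻¹ (g₂ v)⁻¹] · (∏_v g₁ v) · (∏_v g₂ v)` — the record's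
`Λ = Z · L_fin(η₁′) · L_fin(η₂′)` with `Z = L_S · ∏_{v ∈ S_fin} P_{1,v} P_{2,v}`. -/
theorem tprod_eq_of_eq_mul_off_finset {ι : Type*} {f g₁ g₂ : ι → ℂ}
    (hf : Summable (fun v => f v - 1)) (hg₁ : Summable (fun v => g₁ v - 1))
    (hg₂ : Summable (fun v => g₂ v - 1)) (S : Finset ι) (hS : ∀ v ∉ S, f v = g₁ v * g₂ v)
    (h₁ : ∀ v ∈ S, g₁ v ≠ 0) (h₂ : ∀ v ∈ S, g₂ v ≠ 0) :
    ∏' v, f v = ((∏ v ∈ S, f v) * ∏ v ∈ S, ((g₁ v)⁻¹ * (g₂ v)⁻¹)) * (∏' v, g₁ v) * ∏' v, g₂ v := by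
  rw [tprod_eq_prod_mul_tprod_compl hf S, tprod_eq_prod_mul_tprod_compl hg₁ S,
    tprod_eq_prod_mul_tprod_compl hg₂ S]
  have hcompl : ∏' v : {v // v ∉ S}, f v =
      (∏' v : {v // v ∉ S}, g₁ v) * ∏' v : {v // v ∉ S}, g₂ v := by
    rw [← tprod_mul_of_summable (hg₁.subtype fun v => v ∉ S) (hg₂.subtype fun v => v ∉ S)]
    exact tprod_congr fun v => hS v v.2
  rw [hcompl]
  have hne₁ : ∏ v ∈ S, g₁ v ≠ 0 := Finset.prod_ne_zero_iff.2 h₁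
  have hne₂ : ∏ v ∈ S, g₂ v ≠ 0 := Finset.prod_ne_zero_iff.2 h₂
  rw [Finset.prod_mul_distrib, Finset.prod_inv_distrib, Finset.prod_inv_distrib]
  field_simp

/-! ### The abstract main theorem of N4.1 -/

/-- The `Z` of (P4): `Z = L_S · ∏_{v ∈ S} (g₁ v)⁻¹ (g₂ v)⁻¹` as a function of `s`. -/
noncomputable def zFun {ι : Type*} (S : Finset ι) (Lv g₁ g₂ : ι → ℂ → ℂ) : ℂ → ℂ :=
  (∏ v ∈ S, Lv v) * ∏ v ∈ S, ((g₁ v)⁻¹ * (g₂ v)⁻¹)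

/-- `zFun` evaluated. -/
theorem zFun_apply {ι : Type*} (S : Finset ι) (Lv g₁ g₂ : ι → ℂ → ℂ) (s : ℂ) :
    zFun S Lv g₁ g₂ s = (∏ v ∈ S, Lv v s) * ∏ v ∈ S, ((g₁ v s)⁻¹ * (g₂ v s)⁻¹) := by
  simp [zFun]

/-- `zFun` is meromorphic on `ℂ` when the `S`-factors are and the removed Euler factors are entire. -/
theorem meromorphicOn_zFun {ι : Type*} (S : Finset ι) (Lv g₁ g₂ : ι → ℂ → ℂ)
    (hS : ∀ v ∈ S, MeromorphicOn (Lv v) Set.univ)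
    (hg₁ : ∀ v ∈ S, AnalyticOnNhd ℂ (g₁ v)⁻¹ Set.univ)
    (hg₂ : ∀ v ∈ S, AnalyticOnNhd ℂ (g₂ v)⁻¹ Set.univ) :
    MeromorphicOn (zFun S Lv g₁ g₂) Set.univ := by
  refine (meromorphicOn_prod hS).mul (meromorphicOn_prod fun v hv => ?_)
  exact ((hg₁ v hv).meromorphicOn).mul ((hg₂ v hv).meromorphicOn)

/-- (P2)+(P3): `zFun` has order `≤ 0` at `x` (zero-free) when every `S`-factor has order `≤ 0` at
`x` and every removed Euler factor is analytic and non-zero at `x`. -/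
theorem meromorphicOrderAt_zFun_le_zero {ι : Type*} (S : Finset ι) (Lv g₁ g₂ : ι → ℂ → ℂ) {x : ℂ}
    (hS : ∀ v ∈ S, MeromorphicAt (Lv v) x ∧ meromorphicOrderAt (Lv v) x ≤ 0)
    (hg₁ : ∀ v ∈ S, AnalyticAt ℂ (g₁ v)⁻¹ x ∧ (g₁ v)⁻¹ x ≠ 0)
    (hg₂ : ∀ v ∈ S, AnalyticAt ℂ (g₂ v)⁻¹ x ∧ (g₂ v)⁻¹ x ≠ 0) :
    meromorphicOrderAt (zFun S Lv g₁ g₂) x ≤ 0 := by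
  unfold zFun
  have hA : meromorphicOrderAt (∏ v ∈ S, Lv v) x ≤ 0 :=
    meromorphicOrderAt_prod_nonpos (fun v hv => (hS v hv).1) (fun v hv => (hS v hv).2)
  have hB : meromorphicOrderAt (∏ v ∈ S, ((g₁ v)⁻¹ * (g₂ v)⁻¹)) x = 0 := by
    refine meromorphicOrderAt_prod_eq_zero (fun v hv => (hg₁ v hv).1.mul (hg₂ v hv).1)
      (fun v hv => ?_)
    exact mul_ne_zero (hg₁ v hv).2 (hg₂ v hv).2
  rw [meromorphicOrderAt_mul (MeromorphicAt.prod fun v hv => (hS v hv).1)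
    (MeromorphicAt.prod fun v hv => ((hg₁ v hv).1.mul (hg₂ v hv).1).meromorphicAt), hB, add_zero]
  exact hA

/-- **N4.1 over abstract carriers.** Places `ι`, a finite set `S` of them, the local factors
`Lv v` of the doubling L-function `Λ`, the local factors `g_i v` of the finite Hecke L-functions
`L_i = L_fin(s, η_i′)` (factor `1` at the archimedean places).  Hypotheses, each in the shape of its
M2 display: the Euler products are absolutely convergent for `Re s > σ₀` (Lapid–Rallis / Iwasawa);
`Λ`, `L₁`, `L₂` are meromorphic on `ℂ` (Lapid–Rallis Thm 4(10), Iwasawa Thm 3.1); off `S` the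
doubling factor is the product of the two Hecke factors ((P3)+(P7)); on `S` the doubling factors are
meromorphic and zero-free at `x` ((P2)) and the removed Hecke factors have entire, non-vanishing
inverses ((P3), T5 col. 4); the Iwasawa dichotomy for `L₁`, `L₂` at `x` (Thm 3.1 + Prop. 4.4); and
`Λ` is analytic at `x` (GQT Thm 11.4(ii) under `(H_loc)`).  Conclusion: (R1) — `Λ` is holomorphic and
non-zero at `x` — together with the non-triviality of both characters and `ord_x Z = 0`. -/
theorem R1_of_eulerProducts {ι : Type*} (S : Finset ι) (Lv g₁ g₂ : ι → ℂ → ℂ) (Λ L₁ L₂ : ℂ → ℂ)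
    {σ₀ : ℝ} {x : ℂ} {η₁triv η₂triv : Prop}
    (hΛe : ∀ s : ℂ, σ₀ < s.re → Summable (fun v => Lv v s - 1) ∧ Λ s = ∏' v, Lv v s)
    (h₁e : ∀ s : ℂ, σ₀ < s.re → Summable (fun v => g₁ v s - 1) ∧ L₁ s = ∏' v, g₁ v s)
    (h₂e : ∀ s : ℂ, σ₀ < s.re → Summable (fun v => g₂ v s - 1) ∧ L₂ s = ∏' v, g₂ v s)
    (hΛm : MeromorphicOn Λ Set.univ) (h₁m : MeromorphicOn L₁ Set.univ)
    (h₂m : MeromorphicOn L₂ Set.univ)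
    (hunr : ∀ v ∉ S, ∀ s : ℂ, Lv v s = g₁ v s * g₂ v s)
    (hS : ∀ v ∈ S, MeromorphicOn (Lv v) Set.univ ∧ meromorphicOrderAt (Lv v) x ≤ 0)
    (hg₁ : ∀ v ∈ S, AnalyticOnNhd ℂ (g₁ v)⁻¹ Set.univ ∧ (g₁ v)⁻¹ x ≠ 0 ∧
      ∀ s : ℂ, σ₀ < s.re → g₁ v s ≠ 0)
    (hg₂ : ∀ v ∈ S, AnalyticOnNhd ℂ (g₂ v)⁻¹ Set.univ ∧ (g₂ v)⁻¹ x ≠ 0 ∧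
      ∀ s : ℂ, σ₀ < s.re → g₂ v s ≠ 0)
    (hI₁ : η₁triv → meromorphicOrderAt L₁ x = -1)
    (hI₁' : ¬ η₁triv → AnalyticAt ℂ L₁ x ∧ L₁ x ≠ 0)
    (hI₂ : η₂triv → meromorphicOrderAt L₂ x = -1)
    (hI₂' : ¬ η₂triv → AnalyticAt ℂ L₂ x ∧ L₂ x ≠ 0)
    (hhol : AnalyticAt ℂ Λ x) :
    (AnalyticAt ℂ Λ x ∧ Λ x ≠ 0) ∧ ¬ η₁triv ∧ ¬ η₂triv ∧
      meromorphicOrderAt (zFun S Lv g₁ g₂) x = 0 := by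
  have hZm : MeromorphicOn (zFun S Lv g₁ g₂) Set.univ :=
    meromorphicOn_zFun S Lv g₁ g₂ (fun v hv => (hS v hv).1) (fun v hv => (hg₁ v hv).1)
      (fun v hv => (hg₂ v hv).1)
  have hZ0 : meromorphicOrderAt (zFun S Lv g₁ g₂) x ≤ 0 :=
    meromorphicOrderAt_zFun_le_zero S Lv g₁ g₂ (fun v hv => ⟨(hS v hv).1 x trivial, (hS v hv).2⟩)
      (fun v hv => ⟨(hg₁ v hv).1 x trivial, (hg₁ v hv).2.1⟩)
      (fun v hv => ⟨(hg₂ v hv).1 x trivial, (hg₂ v hv).2.1⟩)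
  have heq : ∀ s : ℂ, σ₀ < s.re → Λ s = zFun S Lv g₁ g₂ s * L₁ s * L₂ s := by
    intro s hs
    rw [(hΛe s hs).2, (h₁e s hs).2, (h₂e s hs).2, zFun_apply]
    exact tprod_eq_of_eq_mul_off_finset (hΛe s hs).1 (h₁e s hs).1 (h₂e s hs).1 S
      (fun v hv => hunr v hv s) (fun v hv => (hg₁ v hv).2.2 s hs) (fun v hv => (hg₂ v hv).2.2 s hs)
  obtain ⟨hn₁, hn₂, hne, hZ⟩ :=
    core_of_halfPlane hΛm hZm h₁m h₂m heq hZ0 hI₁ hI₁' hI₂ hI₂' hhol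
  exact ⟨⟨hhol, hne⟩, hn₁, hn₂, hZ⟩

/-- The removed unramified Hecke Euler factor `s ↦ (1 − a q^{-s})⁻¹` of a unitary character
(`‖a‖ ≤ 1`, `q > 1`) satisfies the `hg` hypothesis of `R1_of_eulerProducts` at every `x` with
`Re x > 0` and on every half-plane `Re s > σ₀` with `σ₀ ≥ 0`: its inverse is entire and
non-vanishing there. -/
theorem heckeFactor_hyp {a : ℂ} (ha : ‖a‖ ≤ 1) {q : ℝ} (hq : 1 < q) {x : ℂ} (hx : 0 < x.re)
    {σ₀ : ℝ} (hσ : 0 ≤ σ₀) :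
    AnalyticOnNhd ℂ (fun s : ℂ => (1 - a * (q : ℂ) ^ (-s))⁻¹)⁻¹ Set.univ ∧
      (fun s : ℂ => (1 - a * (q : ℂ) ^ (-s))⁻¹)⁻¹ x ≠ 0 ∧
      ∀ s : ℂ, σ₀ < s.re → (1 - a * (q : ℂ) ^ (-s))⁻¹ ≠ 0 := by
  refine ⟨fun y _ => ?_, ?_, fun s hs => ?_⟩
  · simpa only [Pi.inv_def, inv_inv] using analyticAt_one_sub_mul_cpow a (zero_lt_one.trans hq) y
  · simpa only [Pi.inv_apply, inv_inv] using one_sub_mul_cpow_ne_zero ha hq hx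
  · exact inv_ne_zero (one_sub_mul_cpow_ne_zero ha hq (hσ.trans_lt hs))

/-! ### Absolute convergence of the doubling product from the Hecke products -/

/-- A summable family in `ℂ` is bounded in norm by the sum of the norms. -/
theorem norm_le_tsum_norm {ι : Type*} {f : ι → ℂ} (hf : Summable f) (v : ι) :
    ‖f v‖ ≤ ∑' w, ‖f w‖ :=
  hf.norm.le_tsum v (fun _ _ => norm_nonneg _)

/-- If `f v = g₁ v · g₂ v` off a finite set `S` and the Hecke products converge absolutely
(`Summable (g_i − 1)`), then so does the doubling product: `Summable (f − 1)`.  Off `S`,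
`f − 1 = (g₁ − 1)(g₂ − 1) + (g₁ − 1) + (g₂ − 1)`, and the product term is dominated by
`C · ‖g₁ − 1‖`. -/
theorem summable_sub_one_of_eq_mul_off_finset {ι : Type*} {f g₁ g₂ : ι → ℂ}
    (hg₁ : Summable (fun v => g₁ v - 1)) (hg₂ : Summable (fun v => g₂ v - 1)) (S : Finset ι)
    (hS : ∀ v ∉ S, f v = g₁ v * g₂ v) : Summable (fun v => f v - 1) := by
  have hprod : Summable (fun v => (g₁ v - 1) * (g₂ v - 1)) := by
    refine Summable.of_norm_bounded (g := fun v => (∑' w, ‖g₂ w - 1‖) * ‖g₁ v - 1‖)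
      (hg₁.norm.mul_left _) (fun v => ?_)
    rw [norm_mul, mul_comm]
    exact mul_le_mul_of_nonneg_right (norm_le_tsum_norm hg₂ v) (norm_nonneg _)
  have hsum : Summable (fun v => (g₁ v - 1) * (g₂ v - 1) + (g₁ v - 1) + (g₂ v - 1)) :=
    (hprod.add hg₁).add hg₂
  rw [← Finset.summable_compl_iff S]
  have h := hsum.subtype (fun v => v ∉ S)
  refine h.congr fun v => ?_
  simp only [Function.comp_apply]
  rw [hS v v.2]
  ring

/-- `R1_of_eulerProducts` with the doubling Euler product given only as Lapid–Rallis print it — «Define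
`L(s, π × ω) = ∏_v L(s, π_v × ω_v)`» (the value of the product wherever it converges) — the absolute
convergence for `Re s > σ₀` being DERIVED from the Hecke products and the unramified identity
(`summable_sub_one_of_eq_mul_off_finset`). -/
theorem R1_of_eulerProducts' {ι : Type*} (S : Finset ι) (Lv g₁ g₂ : ι → ℂ → ℂ) (Λ L₁ L₂ : ℂ → ℂ)
    {σ₀ : ℝ} {x : ℂ} {η₁triv η₂triv : Prop}
    (hΛdef : ∀ s : ℂ, Multipliable (fun v => Lv v s) → Λ s = ∏' v, Lv v s)
    (h₁e : ∀ s : ℂ, σ₀ < s.re → Summable (fun v => g₁ v s - 1) ∧ L₁ s = ∏' v, g₁ v s)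
    (h₂e : ∀ s : ℂ, σ₀ < s.re → Summable (fun v => g₂ v s - 1) ∧ L₂ s = ∏' v, g₂ v s)
    (hΛm : MeromorphicOn Λ Set.univ) (h₁m : MeromorphicOn L₁ Set.univ)
    (h₂m : MeromorphicOn L₂ Set.univ)
    (hunr : ∀ v ∉ S, ∀ s : ℂ, Lv v s = g₁ v s * g₂ v s)
    (hS : ∀ v ∈ S, MeromorphicOn (Lv v) Set.univ ∧ meromorphicOrderAt (Lv v) x ≤ 0)
    (hg₁ : ∀ v ∈ S, AnalyticOnNhd ℂ (g₁ v)⁻¹ Set.univ ∧ (g₁ v)⁻¹ x ≠ 0 ∧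
      ∀ s : ℂ, σ₀ < s.re → g₁ v s ≠ 0)
    (hg₂ : ∀ v ∈ S, AnalyticOnNhd ℂ (g₂ v)⁻¹ Set.univ ∧ (g₂ v)⁻¹ x ≠ 0 ∧
      ∀ s : ℂ, σ₀ < s.re → g₂ v s ≠ 0)
    (hI₁ : η₁triv → meromorphicOrderAt L₁ x = -1)
    (hI₁' : ¬ η₁triv → AnalyticAt ℂ L₁ x ∧ L₁ x ≠ 0)
    (hI₂ : η₂triv → meromorphicOrderAt L₂ x = -1)
    (hI₂' : ¬ η₂triv → AnalyticAt ℂ L₂ x ∧ L₂ x ≠ 0)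
    (hhol : AnalyticAt ℂ Λ x) :
    (AnalyticAt ℂ Λ x ∧ Λ x ≠ 0) ∧ ¬ η₁triv ∧ ¬ η₂triv ∧
      meromorphicOrderAt (zFun S Lv g₁ g₂) x = 0 := by
  refine R1_of_eulerProducts S Lv g₁ g₂ Λ L₁ L₂ (σ₀ := σ₀) (fun s hs => ?_) h₁e h₂e hΛm h₁m h₂m
    hunr hS hg₁ hg₂ hI₁ hI₁' hI₂ hI₂' hhol
  have hsum : Summable (fun v => Lv v s - 1) :=
    summable_sub_one_of_eq_mul_off_finset (h₁e s hs).1 (h₂e s hs).1 S (fun v hv => hunr v hv s)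
  exact ⟨hsum, hΛdef s (multipliable_of_summable_sub_one hsum)⟩

end N41Core
end Summit.Ventures.HodgeRepro2.T6
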